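import Mathlib
import Summits.ValiantsHypothesis.ValiantsHypothesis.Theses.DivisionGap
import Literature.Computability.AlgebraicComplexity.ArithCircuitProofs

/-!
# `DivisionGap.PerMultiplesHard` (stmt-ValiantsHypothesis-5068): division with remainder by a
variable — the algebra (part 1 of "dividing a circuit by a variable costs a factor `8`")

The `x_v`-free part `P0 v p = p %ᵐ x_v` and the quotient `P1 v p = p /ᵐ x_v` of a polynomial
(`p = x_v · P1 v p + P0 v p`, `decomp`) over a commutative semiring, and their algebra: additive, scalar,
inputs, and — over additively cancellative coefficients, by uniqueness of division with remainder
(Mathlib `MvPolynomial.eq_divMonomial_single`) — `(uw)₀ = u₀ w₀` (`P0_mul`) and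
`(uw)₁ = u₁ w₀ + u₀ w₁ + x_v u₁ w₁` (`P1_mul`); plus the generic gate-list bookkeeping used by the
circuit transformation of part 2 (`Negative/DivXCircuit.lean`, `complexity_le_of_X_mul`).

This is the degree-one case of "monomial multipliers do not help" (Jukna–Seiwert–Sergeev 2022
Thm 1; Hrubeš–Yehudayoff 2021 Prop 43(3)); it is what the degree-`≤ 1` rung of the crux needs
(workfile `Cruxes/PerMultiplesHard/Disproof.lean` §(j)).  Neutral helper lemmas; no route statement
is asserted.
-/

noncomputable section

namespace Summit.ValiantsHypothesis.Theorems.PerMultiplesHardNegative.DivX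

open MvPolynomial
open Literature.Computability.AlgebraicComplexity ArithCircuit
open ArithCircuit (Gate Operand gateValues gateValues_append_singleton gateValues_length)

variable {k : Type*} [CommSemiring k] {σ : Type*} (v : σ)

/-- The `x_v`-free part. [folklore] -/
abbrev P0 (p : MvPolynomial σ k) : MvPolynomial σ k := p.modMonomial (Finsupp.single v 1)
/-- The quotient part: `p = X v * P1 p + P0 p`. [folklore] -/
abbrev P1 (p : MvPolynomial σ k) : MvPolynomial σ k := p.divMonomial (Finsupp.single v 1)

/-- Division with remainder by a variable: `p = x_v · (p /ᵐ x_v) + p %ᵐ x_v`. [folklore] -/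
theorem decomp (p : MvPolynomial σ k) : X v * P1 v p + P0 v p = p :=
  p.divMonomial_add_modMonomial_single v

/-- The remainder is `x_v`-free. [folklore] -/
theorem support_P0 (p : MvPolynomial σ k) : ∀ n ∈ (P0 v p).support, n v = 0 := by
  intro n hn
  by_contra h
  have hle : Finsupp.single v 1 ≤ n := by
    rw [Finsupp.single_le_iff]; omega
  exact (MvPolynomial.mem_support_iff.1 hn) (coeff_modMonomial_of_le p hle)

section Cancel
variable [IsLeftCancelAdd k]

/-- Remainders multiply: `(pq)₀ = p₀ q₀` (no carry, additively cancellative coefficients). [folklore] -/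
theorem P0_mul (p q : MvPolynomial σ k) : P0 v (p * q) = P0 v p * P0 v q := by
  symm
  apply eq_modMonomial_single (q := P1 v p * P0 v q + P0 v p * P1 v q + X v * (P1 v p * P1 v q))
  · conv_lhs => rw [← decomp v p, ← decomp v q]
    ring
  · intro n hn
    classical
    obtain ⟨a, ha, b, hb, rfl⟩ := Finset.mem_add.1 (support_mul _ _ hn)
    simp [support_P0 v p a ha, support_P0 v q b hb]

/-- Quotients of a product: `(pq)₁ = p₁ q₀ + p₀ q₁ + x_v p₁ q₁`. [folklore] -/
theorem P1_mul (p q : MvPolynomial σ k) :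
    P1 v (p * q) = P1 v p * P0 v q + P0 v p * P1 v q + X v * (P1 v p * P1 v q) := by
  symm
  apply eq_divMonomial_single (r := P0 v p * P0 v q)
  · conv_lhs => rw [← decomp v p, ← decomp v q]
    ring
  · intro n hn
    classical
    obtain ⟨a, ha, b, hb, rfl⟩ := Finset.mem_add.1 (support_mul _ _ hn)
    simp [support_P0 v p a ha, support_P0 v q b hb]

end Cancel

/-- Quotients are additive. [folklore] -/
theorem P1_add (p q : MvPolynomial σ k) : P1 v (p + q) = P1 v p + P1 v q := add_divMonomial _ _ _

/-- Remainders are additive. [folklore] -/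
theorem P0_add (p q : MvPolynomial σ k) : P0 v (p + q) = P0 v p + P0 v q := by
  refine MvPolynomial.ext _ _ fun n => ?_
  by_cases h : Finsupp.single v 1 ≤ n
  · simp [coeff_modMonomial_of_le _ h]
  · simp [coeff_modMonomial_of_not_le _ h]

/-- Quotients commute with scalars. [folklore] -/
theorem P1_smul (c : k) (p : MvPolynomial σ k) : P1 v (c • p) = c • P1 v p := by
  refine MvPolynomial.ext _ _ fun n => ?_
  simp [coeff_divMonomial, coeff_smul]

/-- Remainders commute with scalars. [folklore] -/
theorem P0_smul (c : k) (p : MvPolynomial σ k) : P0 v (c • p) = c • P0 v p := by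
  refine MvPolynomial.ext _ _ fun n => ?_
  by_cases h : Finsupp.single v 1 ≤ n
  · simp [coeff_modMonomial_of_le _ h, coeff_smul]
  · simp [coeff_modMonomial_of_not_le _ h, coeff_smul]

/-- `0 %ᵐ x_v = 0`. [folklore] -/
@[simp] theorem P0_zero : P0 v (0 : MvPolynomial σ k) = 0 := by
  refine MvPolynomial.ext _ _ fun n => ?_
  by_cases h : Finsupp.single v 1 ≤ n
  · simp [coeff_modMonomial_of_le _ h]
  · simp [coeff_modMonomial_of_not_le _ h]

/-- `0 /ᵐ x_v = 0`. [folklore] -/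
@[simp] theorem P1_zero : P1 v (0 : MvPolynomial σ k) = 0 := zero_divMonomial _

/-- `x_v %ᵐ x_v = 0`. [folklore] -/
@[simp] theorem P0_X_self : P0 v (X v : MvPolynomial σ k) = 0 := modMonomial_X v
/-- `x_v /ᵐ x_v = 1`. [folklore] -/
@[simp] theorem P1_X_self : P1 v (X v : MvPolynomial σ k) = 1 := X_divMonomial v

/-- An `x_v`-free polynomial is its own remainder. [folklore] -/
theorem P0_of_support (p : MvPolynomial σ k) (hp : ∀ n ∈ p.support, n v = 0) : P0 v p = p := by
  refine MvPolynomial.ext _ _ fun n => ?_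
  by_cases h : Finsupp.single v 1 ≤ n
  · rw [coeff_modMonomial_of_le _ h]
    symm
    by_contra hne
    have := hp n (MvPolynomial.mem_support_iff.2 hne)
    have h1 : 1 ≤ n v := by simpa [Finsupp.single_le_iff] using h
    omega
  · rw [coeff_modMonomial_of_not_le _ h]

/-- An `x_v`-free polynomial has quotient `0`. [folklore] -/
theorem P1_of_support (p : MvPolynomial σ k) (hp : ∀ n ∈ p.support, n v = 0) : P1 v p = 0 := by
  refine MvPolynomial.ext _ _ fun n => ?_
  rw [coeff_divMonomial, coeff_zero]
  by_contra hne
  have := hp _ (MvPolynomial.mem_support_iff.2 hne)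
  simp at this

/-- Constants are `x_v`-free. [folklore] -/
@[simp] theorem P0_C (c : k) : P0 v (C c : MvPolynomial σ k) = C c :=
  P0_of_support v _ (fun n hn => by
    classical
    rw [support_C] at hn
    split_ifs at hn with h
    · simp at hn
    · rw [Finset.mem_singleton] at hn; simp [hn])

/-- Constants have quotient `0`. [folklore] -/
@[simp] theorem P1_C (c : k) : P1 v (C c : MvPolynomial σ k) = 0 :=
  P1_of_support v _ (fun n hn => by
    classical
    rw [support_C] at hn
    split_ifs at hn with h
    · simp at hn
    · rw [Finset.mem_singleton] at hn; simp [hn])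

/-- Other variables are `x_v`-free. [folklore] -/
theorem P0_X_ne {u : σ} (hu : u ≠ v) : P0 v (X u : MvPolynomial σ k) = X u := by
  nontriviality k
  apply P0_of_support
  intro n hn
  rw [support_X, Finset.mem_singleton] at hn
  simp [hn, hu]

/-- Other variables have quotient `0`. [folklore] -/
theorem P1_X_ne {u : σ} (hu : u ≠ v) : P1 v (X u : MvPolynomial σ k) = 0 := by
  nontriviality k
  apply P1_of_support
  intro n hn
  rw [support_X, Finset.mem_singleton] at hn
  simp [hn, hu]


/-! ### Generic bookkeeping (no decidability needed) -/

section Generic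

/-- Sequential evaluation of a block of gates after the prefix values `w`. [folklore] -/
def evalBlock : List (MvPolynomial σ k) → List (Gate k σ) → List (MvPolynomial σ k)
  | _, [] => []
  | w, g :: B => g.eval w :: evalBlock (w ++ [g.eval w]) B

/-- Evaluating a gate list with an appended block. [folklore] -/
theorem gateValues_append_block (G B : List (Gate k σ)) :
    gateValues (G ++ B) = gateValues G ++ evalBlock (gateValues G) B := by
  induction B generalizing G with
  | nil => simp [evalBlock]
  | cons g B ih =>
    have : G ++ g :: B = (G ++ [g]) ++ B := by simp
    rw [this, ih, gateValues_append_singleton]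
    simp [evalBlock]

variable {v}

/-- Agreement at positions `8j + 6` survives appending up to six further values. [folklore] -/
theorem agree0_append {vals w : List (MvPolynomial σ k)}
    (hA : ∀ j, w.getD (8 * j + 6) 0 = P0 v (vals.getD j 0)) (hw : w.length = 8 * vals.length)
    (L : List (MvPolynomial σ k)) (hL : L.length ≤ 6) :
    ∀ j, (w ++ L).getD (8 * j + 6) 0 = P0 v (vals.getD j 0) := by
  intro j
  by_cases hj : 8 * j + 6 < w.length
  · rw [List.getD_eq_getElem?_getD, List.getElem?_append_left hj, ← List.getD_eq_getElem?_getD]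
    exact hA j
  · have hj' : vals.length ≤ j := by omega
    rw [List.getD_eq_getElem?_getD, List.getD_eq_getElem?_getD,
      List.getElem?_eq_none_iff.2 (by simp; omega), List.getElem?_eq_none_iff.2 hj']
    simp

/-- Agreement at positions `8j + 7` survives appending up to seven further values. [folklore] -/
theorem agree1_append {vals w : List (MvPolynomial σ k)}
    (hA : ∀ j, w.getD (8 * j + 7) 0 = P1 v (vals.getD j 0)) (hw : w.length = 8 * vals.length)
    (L : List (MvPolynomial σ k)) (hL : L.length ≤ 7) :
    ∀ j, (w ++ L).getD (8 * j + 7) 0 = P1 v (vals.getD j 0) := by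
  intro j
  by_cases hj : 8 * j + 7 < w.length
  · rw [List.getD_eq_getElem?_getD, List.getElem?_append_left hj, ← List.getD_eq_getElem?_getD]
    exact hA j
  · have hj' : vals.length ≤ j := by omega
    rw [List.getD_eq_getElem?_getD, List.getD_eq_getElem?_getD,
      List.getElem?_eq_none_iff.2 (by simp; omega), List.getElem?_eq_none_iff.2 hj']
    simp

/-- Reading a value appended inside the current block. [folklore] -/
theorem getD_append_at (w L : List (MvPolynomial σ k)) (j : ℕ) :
    (w ++ L).getD (w.length + j) 0 = L.getD j 0 := by
  rw [List.getD_eq_getElem?_getD, List.getElem?_append_right (Nat.le_add_right _ _),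
    Nat.add_sub_cancel_left, ← List.getD_eq_getElem?_getD]

/-- `1 %ᵐ x_v = 1`. [folklore] -/
@[simp] theorem P0_one : P0 v (1 : MvPolynomial σ k) = 1 := by
  rw [← C_1]; exact P0_C v 1

/-- `1 /ᵐ x_v = 0`. [folklore] -/
@[simp] theorem P1_one : P1 v (1 : MvPolynomial σ k) = 0 := by
  rw [← C_1]; exact P1_C v 1

/-- One step of block evaluation. [folklore] -/
theorem evalBlock_cons (w : List (MvPolynomial σ k)) (g : Gate k σ) (B : List (Gate k σ)) :
    evalBlock w (g :: B) = g.eval w :: evalBlock (w ++ [g.eval w]) B := rfl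

/-- The empty sum gate evaluates to `0`. [folklore] -/
theorem eval_sum_nil' (w : List (MvPolynomial σ k)) : (Gate.sum ([] : List (k × Operand k σ))).eval w = 0 := by
  simp [Gate.eval]

/-- Six dummy gates first. [folklore] -/
theorem evalBlock_six (w : List (MvPolynomial σ k)) (B : List (Gate k σ)) :
    evalBlock w (.sum [] :: .sum [] :: .sum [] :: .sum [] :: .sum [] :: .sum [] :: B) =
      [0, 0, 0, 0, 0, 0] ++ evalBlock (w ++ [0, 0, 0, 0, 0, 0]) B := by
  simp only [evalBlock_cons, eval_sum_nil', List.append_assoc, List.cons_append, List.nil_append]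

end Generic

end Summit.ValiantsHypothesis.Theorems.PerMultiplesHardNegative.DivX

end
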